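import Summits.Ventures.HodgeRepro2.T5InertUnipotentRadical

/-!
# The unipotent cosets in `K a₁ K` at an inert place: the sets `{n ∈ N : a_m n ∈ K a₁ K}`
(cell pub-hodge-repro2, seat p3)

Tier-5 N3 support, towards T5-SATAKE-KERNEL-p3.md row 12. The Satake transform of `T₁ = 1_{K a₁ K}` at the
cell `a_m` is `δ_B^{1/2}(a_m)` times the number of cosets `n N(R) ⊆ N` with `a_m n ∈ K a₁ K`. This file decides,
from the Cartan invariant of file 209 and the explicit matrix `a_m n(x, z)` of file 210, WHICH unipotent elements
satisfy `a_m n ∈ K a₁ K`: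

* `clears_cellZ_mul_upper3_iff` — `ϖ^l` clears `a_m n(x, z)` iff `l + m ≥ 0`, `l − m ≥ 0`, and `ϖ^{l+m} x`,
  `ϖ^{l+m} z`, `ϖ^l x̄/u` are integral;
* `mem_unipCong_iff_isInteger` — `n(x, z) ∈ N_{a,b}` iff `ϖ^{−a} x` and `ϖ^{−b} z` are integral;
* `isInteger_of_isInteger_mul_of_relation` — for `n(x, z) ∈ U(J₃(u))` (`z + z̄ + x̄ x / u = 0`) over a DVR: `ϖ x` and
  `ϖ z` integral force `x` integral (otherwise `ϖ x̄ x ∉ R`);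
* **`satakeSet`** — `{n ∈ N : a_m n ∈ K a_j K}`, and for `j = 1`:
  **`satakeSet_one_one`** `= a₁⁻¹ N(R) a₁`, **`satakeSet_one_zero`** `= a₁⁻¹ N_{1,1} a₁ ∖ N(R)`,
  **`satakeSet_one_neg_one`** `= N(R)`, **`satakeSet_one_of_two_le`** / **`satakeSet_one_of_le_neg_two`** `= ∅`.

Mathlib + this seat's file 210 and its imports; no display; no device.
§8(d): uses an L-value-free non-vanishing device: NO.
-/

namespace Summit.Ventures.HodgeRepro2.T5InertSatakeSets

open Matrix
open Summit.Ventures.HodgeRepro2.T5CartanCellsDistinct Summit.Ventures.HodgeRepro2.T5HeckeBasisCells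
  Summit.Ventures.HodgeRepro2.T5HermitianThreeElements Summit.Ventures.HodgeRepro2.T5UnitaryGroupForm
  Summit.Ventures.HodgeRepro2.T5UnitaryHeckeAdjoint Summit.Ventures.HodgeRepro2.T5UnitaryThreeCorner
  Summit.Ventures.HodgeRepro2.T5InertUnipotentCongruence Summit.Ventures.HodgeRepro2.T5InertCartanInvariant
  Summit.Ventures.HodgeRepro2.T5InertUnipotentRadical

/-! ## Clearing `a_m n(x, z)` -/

section Clearing

variable {R E : Type*} [CommRing R] [Field E] [StarRing E] [Algebra R E] [IsFractionRing R E]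
  (u : E) {ϖ : R} (hϖ : Irreducible ϖ) (hs : star (algebraMap R E ϖ) = algebraMap R E ϖ)

include hϖ in
/-- **`ϖ^l` clears `a_m n(x, z)`** iff `l + m ≥ 0`, `l − m ≥ 0` and `ϖ^{l+m} x`, `ϖ^{l+m} z`, `ϖ^l x̄/u` are
integral. -/
theorem clears_cellZ_mul_upper3_iff (l m : ℤ) (x z : E) :
    Clears R (algebraMap R E ϖ ^ l)
        ((((cellZ u hϖ hs m : formUnitaryGroup (J3 u)) : GL (Fin 3) E) : Matrix (Fin 3) (Fin 3) E) *
          ((upper3 u x z : GL (Fin 3) E) : Matrix (Fin 3) (Fin 3) E)) ↔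
      0 ≤ l + m ∧ 0 ≤ l - m ∧ IsLocalization.IsInteger R (algebraMap R E ϖ ^ (l + m) * x) ∧
        IsLocalization.IsInteger R (algebraMap R E ϖ ^ (l + m) * z) ∧
        IsLocalization.IsInteger R (algebraMap R E ϖ ^ l * (star x / u)) := by
  have hϖ0 : algebraMap R E ϖ ≠ 0 := (map_ne_zero_iff _ (IsFractionRing.injective R E)).2 hϖ.ne_zero
  rw [cellZ_mul_upper3 u hϖ hs, clears_iff]
  constructor
  · intro h
    have h00 : IsLocalization.IsInteger R (algebraMap R E ϖ ^ l * algebraMap R E ϖ ^ m) := h 0 0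
    have h01 : IsLocalization.IsInteger R (algebraMap R E ϖ ^ l * (algebraMap R E ϖ ^ m * x)) := h 0 1
    have h02 : IsLocalization.IsInteger R (algebraMap R E ϖ ^ l * (algebraMap R E ϖ ^ m * z)) := h 0 2
    have h12 : IsLocalization.IsInteger R (algebraMap R E ϖ ^ l * (-star x / u)) := h 1 2
    have h22 : IsLocalization.IsInteger R (algebraMap R E ϖ ^ l * algebraMap R E ϖ ^ (-m)) := h 2 2
    rw [← zpow_add₀ hϖ0, isInteger_zpow_iff hϖ] at h00 h22
    rw [← mul_assoc, ← zpow_add₀ hϖ0] at h01 h02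
    rw [neg_div, mul_neg] at h12
    exact ⟨h00, by simpa only [sub_eq_add_neg] using h22, h01, h02, by simpa using isInteger_neg h12⟩
  · rintro ⟨hlm, hlm', hx, hz, hxs⟩ i j
    have hl : 0 ≤ l := by omega
    fin_cases i <;> fin_cases j
    · exact (by rw [← zpow_add₀ hϖ0]; exact (isInteger_zpow_iff hϖ _).2 hlm :
        IsLocalization.IsInteger R (algebraMap R E ϖ ^ l * algebraMap R E ϖ ^ m))
    · exact (by rw [← mul_assoc, ← zpow_add₀ hϖ0]; exact hx :
        IsLocalization.IsInteger R (algebraMap R E ϖ ^ l * (algebraMap R E ϖ ^ m * x)))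
    · exact (by rw [← mul_assoc, ← zpow_add₀ hϖ0]; exact hz :
        IsLocalization.IsInteger R (algebraMap R E ϖ ^ l * (algebraMap R E ϖ ^ m * z)))
    · exact (by rw [mul_zero]; exact IsLocalization.isInteger_zero :
        IsLocalization.IsInteger R (algebraMap R E ϖ ^ l * 0))
    · exact (by rw [mul_one]; exact (isInteger_zpow_iff hϖ _).2 hl :
        IsLocalization.IsInteger R (algebraMap R E ϖ ^ l * 1))
    · exact (by rw [neg_div, mul_neg]; exact isInteger_neg hxs :
        IsLocalization.IsInteger R (algebraMap R E ϖ ^ l * (-star x / u)))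
    · exact (by rw [mul_zero]; exact IsLocalization.isInteger_zero :
        IsLocalization.IsInteger R (algebraMap R E ϖ ^ l * 0))
    · exact (by rw [mul_zero]; exact IsLocalization.isInteger_zero :
        IsLocalization.IsInteger R (algebraMap R E ϖ ^ l * 0))
    · exact (by rw [← zpow_add₀ hϖ0]; exact (isInteger_zpow_iff hϖ _).2 (by omega) :
        IsLocalization.IsInteger R (algebraMap R E ϖ ^ l * algebraMap R E ϖ ^ (-m)))

end Clearing

/-! ## Membership in `N_{a,b}` by integrality -/

section Cong

variable {R E : Type*} [CommRing R] [Field E] [StarRing E] [Algebra R E] [IsFractionRing R E]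
  (hstar : ∀ x : E, IsLocalization.IsInteger R x → IsLocalization.IsInteger R (star x))
  (u : E) (hu' : IsLocalization.IsInteger R u⁻¹) {ϖ : R} (hϖ : Irreducible ϖ)
  (hs : star (algebraMap R E ϖ) = algebraMap R E ϖ)

include hϖ in
/-- `n(x, z) ∈ N_{a,b}` iff `ϖ^{−a} x` and `ϖ^{−b} z` are integral. -/
theorem mem_unipCong_iff_isInteger {g : formUnitaryGroup (J3 u)} {x z : E}
    (hg : (g : GL (Fin 3) E) = upper3 u x z) {a b : ℕ} {hab : b ≤ 2 * a} :
    g ∈ unipCong hstar u hu' hs a b hab ↔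
      IsLocalization.IsInteger R (algebraMap R E ϖ ^ (-(a : ℤ)) * x) ∧
        IsLocalization.IsInteger R (algebraMap R E ϖ ^ (-(b : ℤ)) * z) := by
  have hϖ0 : algebraMap R E ϖ ≠ 0 := (map_ne_zero_iff _ (IsFractionRing.injective R E)).2 hϖ.ne_zero
  rw [mem_unipCong_iff, hg]
  constructor
  · rintro ⟨x', z', h⟩
    obtain ⟨hx, hz⟩ := upper3_inj u h
    refine ⟨⟨x', ?_⟩, ⟨z', ?_⟩⟩
    · rw [hx, _root_.zpow_neg, zpow_natCast, inv_mul_cancel_left₀ (pow_ne_zero _ hϖ0)]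
    · rw [hz, _root_.zpow_neg, zpow_natCast, inv_mul_cancel_left₀ (pow_ne_zero _ hϖ0)]
  · rintro ⟨⟨x', hx'⟩, ⟨z', hz'⟩⟩
    refine ⟨x', z', ?_⟩
    rw [hx', hz', ← mul_assoc, ← mul_assoc, ← zpow_natCast, ← zpow_natCast, ← zpow_add₀ hϖ0,
      ← zpow_add₀ hϖ0, add_neg_cancel, add_neg_cancel, zpow_zero, one_mul, one_mul]

end Cong

/-! ## The arithmetic lemma: `ϖ x`, `ϖ z` integral and `z + z̄ + x̄ x / u = 0` force `x` integral -/

section Arith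

variable {R E : Type*} [CommRing R] [IsDomain R] [IsDiscreteValuationRing R] [Field E] [StarRing E]
  [Algebra R E] [IsFractionRing R E]
  (hstar : ∀ x : E, IsLocalization.IsInteger R x → IsLocalization.IsInteger R (star x))
  (u : E) (hsu : star u = u) (hu0 : u ≠ 0) (hu : IsLocalization.IsInteger R u)
  {ϖ : R} (hϖ : Irreducible ϖ) (hs : star (algebraMap R E ϖ) = algebraMap R E ϖ)

include hstar hϖ hs in
/-- If `ϖ x` is integral but `x` is not, then `ϖ x̄ x` is not integral (`v(ϖ x̄ x) = 1 + 2 v(x) ≤ −1`). -/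
theorem not_isInteger_mul_star_mul_of_not_isInteger {x : E} (hx : ¬ IsLocalization.IsInteger R x)
    (hϖx : IsLocalization.IsInteger R (algebraMap R E ϖ * x)) :
    ¬ IsLocalization.IsInteger R (algebraMap R E ϖ * star x * x) := by
  have hϖ0 : algebraMap R E ϖ ≠ 0 := (map_ne_zero_iff _ (IsFractionRing.injective R E)).2 hϖ.ne_zero
  obtain ⟨r, hr⟩ := hϖx
  -- `r = ϖ x` is a unit of `R`: otherwise `r ∈ ϖ R` and `x ∈ R`
  have hru : IsUnit r := by
    by_contra hnu
    have hnu' : r ∈ IsLocalRing.maximalIdeal R := (IsLocalRing.mem_maximalIdeal r).2 (mem_nonunits_iff.2 hnu)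
    rw [hϖ.maximalIdeal_eq, Ideal.mem_span_singleton] at hnu'
    obtain ⟨r', hr'⟩ := hnu'
    refine hx ⟨r', ?_⟩
    apply mul_left_cancel₀ hϖ0
    rw [← hr, hr', map_mul]
  obtain ⟨ru, rfl⟩ := hru
  intro hint
  have hrinv : IsLocalization.IsInteger R (algebraMap R E (ru : R))⁻¹ :=
    ⟨((ru⁻¹ : Rˣ) : R), map_units_inv (algebraMap R E) ru⟩
  have hsr : IsLocalization.IsInteger R (star (algebraMap R E (ru : R)))⁻¹ := isInteger_star_inv hstar hrinv
  -- `x = r ϖ⁻¹`, hence `ϖ x̄ x = r̄ r ϖ⁻¹`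
  have hxeq : x = algebraMap R E (ru : R) * (algebraMap R E ϖ)⁻¹ := by
    rw [eq_mul_inv_iff_mul_eq₀ hϖ0, mul_comm, ← hr]
  have hkey : algebraMap R E ϖ * star x * x =
      star (algebraMap R E (ru : R)) * algebraMap R E (ru : R) * (algebraMap R E ϖ)⁻¹ := by
    rw [hxeq, star_mul, star_inv₀, hs]
    field_simp
  -- so `ϖ⁻¹ = r̄⁻¹ r⁻¹ (ϖ x̄ x)` would be integral
  have hr0 : algebraMap R E (ru : R) ≠ 0 := (map_ne_zero_iff _ (IsFractionRing.injective R E)).2 ru.ne_zero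
  have hsr0 : star (algebraMap R E (ru : R)) ≠ 0 := star_ne_zero.2 hr0
  have hinv : IsLocalization.IsInteger R (algebraMap R E ϖ)⁻¹ := by
    have := IsLocalization.isInteger_mul (IsLocalization.isInteger_mul hsr hrinv) hint
    rw [hkey] at this
    convert this using 1
    field_simp
  have := (isInteger_zpow_iff (E := E) hϖ (-1)).1 (by rwa [_root_.zpow_neg_one])
  omega

end Arith

/-! ## The unitary relation of `n(x, z)` -/

section Relation

variable {E : Type*} [Field E] [StarRing E] (u : E) (hsu : star u = u) (hu0 : u ≠ 0)

include hsu hu0 in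
/-- `n(x, z) ∈ U(J₃(u))` forces `z + z̄ + x̄ x / u = 0`. -/
theorem relation_of_upper3_mem {x z : E} (h : upper3 u x z ∈ formUnitaryGroup (J3 u)) :
    z + star z + star x * x / u = 0 := by
  rw [mem_iff_fin_three u _ 1 x z 0 1 (-star x / u) 0 0 1 (coe_upper3 u x z)] at h
  have h22 := h.2.2.2.2.2.2.2.2
  rw [star_one, one_mul, mul_one, star_div₀, star_neg, star_star, hsu] at h22
  have : -x / u * u * (-star x / u) = star x * x / u := by field_simp
  rw [this] at h22
  linear_combination h22

end Relation

/-! ## The sets `{n ∈ N : a_m n ∈ K a_j K}` -/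

section Sets

variable {R E : Type*} [CommRing R] [IsDomain R] [IsDiscreteValuationRing R] [Field E] [StarRing E]
  [Algebra R E] [IsFractionRing R E] [Finite (IsLocalRing.ResidueField R)]
  (hstar : ∀ x : E, IsLocalization.IsInteger R x → IsLocalization.IsInteger R (star x))
  (u : E) (hsu : star u = u) (hu0 : u ≠ 0) (hu : IsLocalization.IsInteger R u)
  (hu' : IsLocalization.IsInteger R u⁻¹) {ϖ : R} (hϖ : Irreducible ϖ)
  (hs : star (algebraMap R E ϖ) = algebraMap R E ϖ)

/-- **The unipotent elements `n` with `a_m n ∈ K a_j K`.** -/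
def satakeSet (j : ℕ) (m : ℤ) : Set (formUnitaryGroup (J3 u)) :=
  {n | n ∈ upperUnipotent u ∧
    ((cellZ u hϖ hs m * n : formUnitaryGroup (J3 u)) :
        formUnitaryGroup (J3 u) ⧸ hyperspecialSubgroup R (J3 u)) ∈
      MulAction.orbit (hyperspecialSubgroup R (J3 u))
        ((cellU hϖ hs u j : formUnitaryGroup (J3 u)) :
          formUnitaryGroup (J3 u) ⧸ hyperspecialSubgroup R (J3 u))}

include hstar hsu hu0 hu hu' in
/-- Membership in `satakeSet 1 m` for `n = n(x, z)`, by the Cartan invariant. -/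
theorem mem_satakeSet_one_iff {n : formUnitaryGroup (J3 u)} {x z : E}
    (hn : (n : GL (Fin 3) E) = upper3 u x z) (m : ℤ) :
    n ∈ satakeSet (R := R) u hϖ hs 1 m ↔
      (0 ≤ 1 + m ∧ 0 ≤ 1 - m ∧ IsLocalization.IsInteger R (algebraMap R E ϖ ^ (1 + m) * x) ∧
        IsLocalization.IsInteger R (algebraMap R E ϖ ^ (1 + m) * z) ∧
        IsLocalization.IsInteger R (algebraMap R E ϖ ^ (1 : ℤ) * (star x / u))) ∧
      ¬ (0 ≤ 0 + m ∧ 0 ≤ 0 - m ∧ IsLocalization.IsInteger R (algebraMap R E ϖ ^ (0 + m) * x) ∧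
        IsLocalization.IsInteger R (algebraMap R E ϖ ^ (0 + m) * z) ∧
        IsLocalization.IsInteger R (algebraMap R E ϖ ^ (0 : ℤ) * (star x / u))) := by
  rw [satakeSet, Set.mem_setOf_eq, and_iff_right ⟨x, z, hn⟩,
    mem_orbit_cellU_one_iff hstar u hsu hu0 hu hu' hϖ hs, Subgroup.coe_mul, Units.val_mul, hn,
    Nat.cast_one, Nat.cast_zero, clears_cellZ_mul_upper3_iff u hϖ hs, clears_cellZ_mul_upper3_iff u hϖ hs]

omit [IsDomain R] [IsDiscreteValuationRing R] [Finite (IsLocalRing.ResidueField R)] in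
/-- The conjugate `a_m N_{a,b} a_m⁻¹` consists of unipotent elements. -/
theorem map_conj_cellZ_unipCong_le_upperUnipotent (m : ℤ) (a b : ℕ) (hab : b ≤ 2 * a) :
    (unipCong hstar u hu' hs a b hab).map (MulAut.conj (cellZ u hϖ hs m)).toMonoidHom ≤ upperUnipotent u := by
  rintro n ⟨n', ⟨x, z, hn'⟩, rfl⟩
  refine ⟨algebraMap R E ϖ ^ m * (algebraMap R E ϖ ^ a * algebraMap R E x),
    algebraMap R E ϖ ^ (2 * m) * (algebraMap R E ϖ ^ b * algebraMap R E z), ?_⟩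
  rw [MulEquiv.coe_toMonoidHom, MulAut.conj_apply, Subgroup.coe_mul, Subgroup.coe_mul, Subgroup.coe_inv, hn',
    cellZ_mul_upper3_mul_cellZ_inv]

omit [IsDomain R] [IsDiscreteValuationRing R] [Finite (IsLocalRing.ResidueField R)] in
include hϖ in
/-- Membership in `a₁⁻¹ N_{a,b} a₁` for `n = n(x, z)`: `ϖ^{1−a} x` and `ϖ^{2−b} z` integral. -/
theorem mem_map_conj_cellZ_neg_one_iff {n : formUnitaryGroup (J3 u)} {x z : E}
    (hn : (n : GL (Fin 3) E) = upper3 u x z) (a b : ℕ) (hab : b ≤ 2 * a) :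
    n ∈ (unipCong hstar u hu' hs a b hab).map (MulAut.conj (cellZ u hϖ hs (-1))).toMonoidHom ↔
      IsLocalization.IsInteger R (algebraMap R E ϖ ^ (-(a : ℤ)) * (algebraMap R E ϖ ^ (1 : ℤ) * x)) ∧
        IsLocalization.IsInteger R (algebraMap R E ϖ ^ (-(b : ℤ)) * (algebraMap R E ϖ ^ (2 * (1 : ℤ)) * z)) := by
  rw [Subgroup.mem_map_equiv]
  have hconj : (((MulAut.conj (cellZ u hϖ hs (-1))).symm n : formUnitaryGroup (J3 u)) : GL (Fin 3) E) =
      upper3 u (algebraMap R E ϖ ^ (1 : ℤ) * x) (algebraMap R E ϖ ^ (2 * (1 : ℤ)) * z) := by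
    rw [MulAut.conj_symm_apply, cellZ_neg, inv_inv, Subgroup.coe_mul, Subgroup.coe_mul, Subgroup.coe_inv, hn,
      cellZ_mul_upper3_mul_cellZ_inv]
  exact mem_unipCong_iff_isInteger hstar u hu' hϖ hs hconj

include hstar hsu hu0 hu hu' in
/-- **`{n ∈ N : a₁ n ∈ K a₁ K} = a₁⁻¹ N(R) a₁`.** -/
theorem satakeSet_one_one :
    satakeSet (R := R) u hϖ hs 1 1 =
      ((unipCong hstar u hu' hs 0 0 le_rfl).map (MulAut.conj (cellZ u hϖ hs (-1))).toMonoidHom :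
        Set (formUnitaryGroup (J3 u))) := by
  have hϖ0 : algebraMap R E ϖ ≠ 0 := (map_ne_zero_iff _ (IsFractionRing.injective R E)).2 hϖ.ne_zero
  ext n
  constructor
  · rintro ⟨⟨x, z, hn⟩, hmem⟩
    obtain ⟨⟨-, -, hx2, hz2, hxs⟩, -⟩ := (mem_satakeSet_one_iff hstar u hsu hu0 hu hu' hϖ hs hn 1).1 ⟨⟨x, z, hn⟩, hmem⟩
    rw [SetLike.mem_coe, mem_map_conj_cellZ_neg_one_iff hstar u hu' hϖ hs hn]
    simp only [Nat.cast_zero, neg_zero, zpow_zero, one_mul, mul_one, zpow_one]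
    refine ⟨?_, by simpa using hz2⟩
    -- `ϖ x̄/u ∈ R` ⇒ `ϖ x̄ ∈ R` ⇒ `ϖ x ∈ R`
    have h1 : IsLocalization.IsInteger R (algebraMap R E ϖ * star x) := by
      have := IsLocalization.isInteger_mul hxs hu
      rwa [zpow_one, mul_assoc, div_mul_cancel₀ _ hu0] at this
    have h2 := hstar _ h1
    rwa [star_mul, star_star, hs, mul_comm] at h2
  · intro hmem
    obtain ⟨x, z, hn⟩ := map_conj_cellZ_unipCong_le_upperUnipotent hstar u hu' hϖ hs (-1) 0 0 le_rfl hmem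
    rw [SetLike.mem_coe, mem_map_conj_cellZ_neg_one_iff hstar u hu' hϖ hs hn] at hmem
    simp only [Nat.cast_zero, neg_zero, zpow_zero, one_mul, mul_one, zpow_one] at hmem
    obtain ⟨hx, hz⟩ := hmem
    rw [mem_satakeSet_one_iff hstar u hsu hu0 hu hu' hϖ hs hn 1]
    refine ⟨⟨by norm_num, by norm_num, ?_, by simpa using hz, ?_⟩, fun h => by have := h.2.1; omega⟩
    · have := IsLocalization.isInteger_mul (isInteger_pow ϖ 1) hx
      rwa [pow_one, ← mul_assoc, ← zpow_one (algebraMap R E ϖ), ← zpow_add₀ hϖ0] at this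
    · have := IsLocalization.isInteger_mul (hstar _ hx) hu'
      rw [star_mul, hs] at this
      rw [zpow_one, div_eq_mul_inv]
      convert this using 1
      ring

include hstar hsu hu0 hu hu' in
/-- **`{n ∈ N : n ∈ K a₁ K} = a₁⁻¹ N_{1,1} a₁ ∖ N(R)`.** -/
theorem satakeSet_one_zero :
    satakeSet (R := R) u hϖ hs 1 0 =
      ((unipCong hstar u hu' hs 1 1 (by norm_num)).map (MulAut.conj (cellZ u hϖ hs (-1))).toMonoidHom :
        Set (formUnitaryGroup (J3 u))) \ (unipCong hstar u hu' hs 0 0 le_rfl : Set (formUnitaryGroup (J3 u))) := by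
  have hϖ0 : algebraMap R E ϖ ≠ 0 := (map_ne_zero_iff _ (IsFractionRing.injective R E)).2 hϖ.ne_zero
  ext n
  constructor
  · rintro ⟨⟨x, z, hn⟩, hmem⟩
    obtain ⟨⟨-, -, hx1, hz1, hxs⟩, hnot⟩ :=
      (mem_satakeSet_one_iff hstar u hsu hu0 hu hu' hϖ hs hn 0).1 ⟨⟨x, z, hn⟩, hmem⟩
    simp only [add_zero, zpow_one, zpow_zero, one_mul, sub_zero, le_refl, true_and] at hx1 hz1 hxs hnot
    -- `x` is integral: otherwise `ϖ x̄ x = −u (ϖ z + ϖ z̄)` would not be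
    have hrel := relation_of_upper3_mem u hsu hu0 (hn ▸ n.2)
    have hx : IsLocalization.IsInteger R x := by
      by_contra hx
      refine not_isInteger_mul_star_mul_of_not_isInteger hstar hϖ hs hx hx1 ?_
      have h' : star x * x = -(u * (z + star z)) := by
        have := hrel
        field_simp at this
        linear_combination this
      have heq : algebraMap R E ϖ * star x * x =
          -(u * (algebraMap R E ϖ * z + star (algebraMap R E ϖ * z))) := by
        rw [star_mul, hs, mul_assoc, h']
        ring
      rw [heq]
      exact isInteger_neg (IsLocalization.isInteger_mul hu (IsLocalization.isInteger_add hz1 (hstar _ hz1)))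
    refine ⟨?_, fun hN => hnot ⟨hx, ?_, ?_⟩⟩
    · rw [SetLike.mem_coe, mem_map_conj_cellZ_neg_one_iff hstar u hu' hϖ hs hn]
      refine ⟨?_, ?_⟩
      · rw [← mul_assoc, ← zpow_add₀ hϖ0]
        norm_num
        exact hx
      · rw [← mul_assoc, ← zpow_add₀ hϖ0]
        norm_num
        exact hz1
    · have := ((mem_unipCong_iff_isInteger hstar u hu' hϖ hs hn).1 hN).2
      simpa using this
    · rw [div_eq_mul_inv]
      exact IsLocalization.isInteger_mul (hstar _ hx) hu'
  · rintro ⟨hmem, hN⟩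
    obtain ⟨x, z, hn⟩ := map_conj_cellZ_unipCong_le_upperUnipotent hstar u hu' hϖ hs (-1) 1 1 (by norm_num) hmem
    rw [SetLike.mem_coe, mem_map_conj_cellZ_neg_one_iff hstar u hu' hϖ hs hn] at hmem
    rw [← mul_assoc, ← zpow_add₀ hϖ0, ← mul_assoc, ← zpow_add₀ hϖ0] at hmem
    norm_num at hmem
    obtain ⟨hx, hz⟩ := hmem
    have hzR : ¬ IsLocalization.IsInteger R z := fun hzR =>
      hN ((mem_unipCong_iff_isInteger hstar u hu' hϖ hs hn).2 (by simpa using And.intro hx hzR))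
    rw [mem_satakeSet_one_iff hstar u hsu hu0 hu hu' hϖ hs hn 0]
    simp only [add_zero, zpow_one, zpow_zero, one_mul, sub_zero, le_refl, zero_le_one, true_and]
    refine ⟨⟨IsLocalization.isInteger_mul ⟨ϖ, rfl⟩ hx, hz, ?_⟩, fun h => hzR h.2.1⟩
    rw [div_eq_mul_inv]
    exact IsLocalization.isInteger_mul ⟨ϖ, rfl⟩ (IsLocalization.isInteger_mul (hstar _ hx) hu')

include hstar hsu hu0 hu hu' in
/-- **`{n ∈ N : a₁⁻¹ n ∈ K a₁ K} = N(R)`.** -/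
theorem satakeSet_one_neg_one :
    satakeSet (R := R) u hϖ hs 1 (-1) = (unipCong hstar u hu' hs 0 0 le_rfl : Set (formUnitaryGroup (J3 u))) := by
  ext n
  constructor
  · rintro ⟨⟨x, z, hn⟩, hmem⟩
    obtain ⟨⟨-, -, hx, hz, -⟩, -⟩ :=
      (mem_satakeSet_one_iff hstar u hsu hu0 hu hu' hϖ hs hn (-1)).1 ⟨⟨x, z, hn⟩, hmem⟩
    rw [SetLike.mem_coe, mem_unipCong_iff_isInteger hstar u hu' hϖ hs hn]
    simpa using And.intro hx hz
  · intro hN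
    obtain ⟨x, z, hn⟩ := unipCong_le_upperUnipotent u hstar hu' hs hN
    have := (mem_unipCong_iff_isInteger hstar u hu' hϖ hs hn).1 hN
    simp only [Nat.cast_zero, neg_zero, zpow_zero, one_mul] at this
    obtain ⟨hx, hz⟩ := this
    rw [mem_satakeSet_one_iff hstar u hsu hu0 hu hu' hϖ hs hn (-1)]
    refine ⟨⟨by norm_num, by norm_num, by simpa using hx, by simpa using hz, ?_⟩, fun h => by have := h.1; omega⟩
    rw [zpow_one, div_eq_mul_inv]
    exact IsLocalization.isInteger_mul ⟨ϖ, rfl⟩ (IsLocalization.isInteger_mul (hstar _ hx) hu')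

include hstar hsu hu0 hu hu' in
/-- **`{n ∈ N : a_m n ∈ K a₁ K} = ∅` for `m ≥ 2`.** -/
theorem satakeSet_one_of_two_le {m : ℤ} (hm : 2 ≤ m) : satakeSet (R := R) u hϖ hs 1 m = ∅ := by
  ext n
  simp only [Set.mem_empty_iff_false, iff_false]
  rintro ⟨⟨x, z, hn⟩, hmem⟩
  obtain ⟨⟨-, h, -⟩, -⟩ := (mem_satakeSet_one_iff hstar u hsu hu0 hu hu' hϖ hs hn m).1 ⟨⟨x, z, hn⟩, hmem⟩
  omega

include hstar hsu hu0 hu hu' in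
/-- **`{n ∈ N : a_m n ∈ K a₁ K} = ∅` for `m ≤ −2`.** -/
theorem satakeSet_one_of_le_neg_two {m : ℤ} (hm : m ≤ -2) : satakeSet (R := R) u hϖ hs 1 m = ∅ := by
  ext n
  simp only [Set.mem_empty_iff_false, iff_false]
  rintro ⟨⟨x, z, hn⟩, hmem⟩
  obtain ⟨⟨h, -⟩, -⟩ := (mem_satakeSet_one_iff hstar u hsu hu0 hu hu' hϖ hs hn m).1 ⟨⟨x, z, hn⟩, hmem⟩
  omega

end Sets

end Summit.Ventures.HodgeRepro2.T5InertSatakeSets
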